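import Literature.MathematicalPhysics.QuantumFieldTheory.Balaban1983to89.B1Sect1Statements

/-!
# `Balaban1983to89.B1Eq115GeneratingFunctional` — T. Bałaban, *(Higgs)₂,₃ quantum fields in a finite volume. I. A
# lower bound*, Commun. Math. Phys. **85** (1982) 603–626 [Balaban1982Higgs1]: the generating functional Z^ε(J, f)
# of (1.15) p. 606 CONCRETELY on the carrier `HiggsLattice`, r14's abstract source carrier INSTANTIATED, and the
# knitting (1.15) at zero sources ⇒ (1.14)

statement-level skeleton of published theorems with citation tags; proofs where landed; nothing here is a claim about
the Yang–Mills mass gap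

PDF held: `paper:balaban1982-cmp85-higgs23-i` (journal page = PDF page + 602).  Read from the ×2 page render
`run/shared/lean/pub/pub-balaban/b2b-balaban-ref1/pages/1982-cmp85-higgs23-I/1982-cmp85-higgs23-I-p004-x2.png`
(p. 606), not from the OCR layer.

CITATION HEADER (lean-in-tree rule).  This module belongs to the lit-balaban TYPED SKELETON (HOME
`run/shared/lean/pub/lit-balaban/`, SKELETON.md row `B1.Eq1.15` (owner r14; decl of record `B1LowerBound.Ext115Printed`
over the ABSTRACT carrier `B1LowerBound.SourceFamily`, typed p239114), row `B1.Thm@606` (`B1LowerBound.ThmPrinted`);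
unit `lit-balaban-typer` gen 23).  RELATION TO THE TREE (read first; nothing restated):
`…Balaban1983to89.HiggsLattice` (typer) is the concrete carrier of Sect. 1 (tori, fields, the scalar products (1.5)
`siteInner` / `bondInner`, the action (1.11) `action`, the partition function (1.10) `partitionFn`);
`…Balaban1983to89.B1Sect1Statements` (r01) fixes the model data `ModelData`, the renormalized partition function
`ModelData.zRen` (m₀² = m² + δm², E = E₀ + E₁) and the CONCRETE CUTOFF FAMILY `ModelData.cutoffFamily` at which the
Theorem (1.14) is instantiated (`Thm114`); its header records *"(vi) the extension (1.15) is r14's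
`B1LowerBound.Ext115Printed` (abstract sources) and is not instantiated here"*.  WHAT THIS MODULE ADDS (and only
this): (a) the generating functional `genFn D P J f` = Z^ε(J, f) = ∫dA∫dφ exp(−S^ε(A,φ) + ⟨J,A⟩ + ⟨f,φ⟩) — the MIDDLE
MEMBER of (1.15) — with the renormalized action of `zRen` (`couplings`) and the scalar products (1.5); (b) the CONCRETE
SOURCE FAMILY `sourceFamily D : B1LowerBound.SourceFamily {P // D.Admissible P}` extending r01's `cutoffFamily`
(sources `(J, f)` = all vector × scalar field configurations of `T_ε`, norms = the sup norms — the print's *"e.g. we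
can take the norm of L^∞"*), so that (1.15) for the model IS r14's `B1LowerBound.Ext115Printed (sourceFamily D)` — no
new `Prop` is minted; (c) KNITTING, kernel-checked: `genFn_zero_zero` (Z^ε(0, 0) = Z^ε), the abstract lemma
`thmPrinted_of_ext115Printed` (any source family with a section of sources of fixed norms reproducing Z^ε: (1.15) ⇒
(1.14)), and at the model `thmPrinted_sourceFamily_of_ext115Printed` / `thm114_of_ext115Printed` /
`lowerBound114_of_ext115Printed` ((1.15) ⇒ (1.14) ⇒ its lower half, with E_∓ := E_∓(0, 0)); (d) the dictionary
`ext115Printed_sourceFamily_iff` (what (1.15) reads at the concrete family, verbatim).  HONEST SCOPE: nothing of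
(1.15) is asserted — the print gives NO proof (*"Using the same method of proof we can extend the Theorem"*);
`Ext115Printed (sourceFamily D)` is consumed only as a hypothesis; the norm is the sup norm (one admissible reading of
*"some norm"*); the integral `genFn` is a Lebesgue integral over `(bonds → ℝ) × (sites → ℝ^N)` exactly as
`HiggsLattice.partitionFn` (value 0 if not integrable — integrability is not asserted here).

v1.1 (typer gen 24, append-only): §4 re-threads §§2–3 over an ARBITRARY vacuum counterterm `E₁` (r01's
`B1Sect1Statements` v1.1 `zRenWith` / `cutoffFamilyWith` / `Thm114With`, after the typer g24 semantic audit
`B1Eq113OneSidedDerivatives` showed that the v1.0 `e1` drops the `λ`-counterterms of (1.13) under Lean's two-sided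
`iteratedDeriv`): `couplingsWith`, `genFnWith`, `sourceFamilyWith E₁`, the REPAIRED concrete instance
`sourceFamilyR = sourceFamilyWith D D.e1R`, and the knitting `thm114With_of_ext115Printed` /
`thm114R_of_ext115Printed` / `lowerBound114R_of_ext115Printed`; the v1.0 objects are the `E₁ = e1` instances
(`couplings_eq_couplingsWith`, `genFn_eq_genFnWith`, `sourceFamily_eq_sourceFamilyWith`, all `rfl`).

## The print (verbatim, p. 606 [PDF 4])

«Let us make some comments on this Theorem. First, we would like to stress that the assumption λ > 0 is essential
for our method. The second remark concerns the estimates of a generating functional. Using the same method of proof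
we can extend the Theorem in several ways. One of the simplest extensions is
exp(−E₋(‖J‖, ‖f‖)|T_ε|) ≦ Z^ε(J, f) = ∫dA∫dφ exp(−S^ε(A,φ) + ⟨J,A⟩ + ⟨f,φ⟩) ≦ exp(E₊(‖J‖, ‖f‖)|T_ε|), (1.15)
where the "sources" J, f are arbitrary, ‖·‖ is some norm, e.g. we can take the norm of L^∞, and the functions
E_±(·,·) are continuous and independent of ε, T_ε. Using the techniques developed in [11, 16, 25] it is possible
to prove more refined estimates.»
-/

namespace Literature.MathematicalPhysics.QuantumFieldTheory.Balaban1983to89.B1Eq115GeneratingFunctional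

open HiggsLattice B1Sect1Statements MeasureTheory

/-! ## 1. Knitting over the abstract carrier: (1.15) at a fixed source ⇒ (1.14) -/

section Abstract

variable {I : Type}

/-- KNITTING (abstract, kernel-checked): if a source family carries, at every cutoff, a source `z i` of FIXED norms
`(a, b)` whose generating functional is the partition function (`ZS i (z i) = Z i`; in print `J = f = 0`,
`Z^ε(0, 0) = Z^ε`), then the extension (1.15) gives the Theorem (1.14) with `E_∓ := E_∓(a, b)`.
[cite: Balaban1982Higgs1, (1.14)–(1.15) p.606] -/
theorem thmPrinted_of_ext115Printed (F : B1LowerBound.SourceFamily I) (a b : ℝ) (z : (i : I) → F.Src i)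
    (hJ : ∀ i, F.nJ i (z i) = a) (hf : ∀ i, F.nf i (z i) = b) (hZ : ∀ i, F.ZS i (z i) = F.Z i)
    (h : B1LowerBound.Ext115Printed F) : B1LowerBound.ThmPrinted F.toCutoffFamily := by
  obtain ⟨Em, Ep, -, -, hb⟩ := h
  refine ⟨Em a b, Ep a b, fun i => ?_⟩
  have hi := hb i (z i)
  rw [hJ i, hf i, hZ i] at hi
  exact hi

end Abstract

/-! ## 2. The generating functional Z^ε(J, f) of (1.15) on the concrete carrier -/

section Model

variable (D : ModelData)

/-- The couplings of the renormalized partition function `Z^ε` of the Theorem (r01's `ModelData.zRen`): charge `e`,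
`m₀² = m² + δm²(ε, e, λ)`, `λ`, `μ₀²`, `E = E₀ + E₁` ((1.11)–(1.13)). [cite: Balaban1982Higgs1, (1.10)–(1.13) pp.605–606] -/
noncomputable def couplings (P : Params) : Couplings :=
  ⟨D.msq + D.δmsq P.ε D.C.e D.lam, D.lam, D.mu0sq, D.e0 P + D.e1 P⟩

/-- DICTIONARY (definitional): r01's `zRen` is the partition function (1.10) of `HiggsLattice` at these couplings.
[cite: Balaban1982Higgs1, (1.10)–(1.13) pp.605–606] -/
theorem zRen_eq_partitionFn (P : Params) : D.zRen P = partitionFn P 0 D.N D.C (couplings D P) := rfl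

/-- **Z^ε(J, f)** — the generating functional, the middle member of (1.15) p. 606 (verbatim):
*"Z^ε(J, f) = ∫dA∫dφ exp(−S^ε(A,φ) + ⟨J,A⟩ + ⟨f,φ⟩)"*, with the action `S^ε` (1.11) of the Theorem's `Z^ε`
(counterterms included, `couplings`), the scalar products (1.5) (`bondInner` for `⟨J,A⟩`, `siteInner` for `⟨f,φ⟩`)
and the product Lebesgue measure of (1.10) (`HiggsLattice.partitionFn`'s). Sources: `J` a vector field, `f` a scalar
field on `T_ε = T^{(0)}`. [cite: Balaban1982Higgs1, (1.15) p.606] -/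
noncomputable def genFn (P : Params) (J : VecField P 0) (f : ScalarField P 0 D.N) : ℝ :=
  ∫ Φ : VecField P 0 × ScalarField P 0 D.N,
    Real.exp (-action D.C (couplings D P) Φ.1 Φ.2 + bondInner J Φ.1 + siteInner f Φ.2)

/-- `⟨0, A⟩ = 0` for the scalar product (1.5) on bond functions. [cite: Balaban1982Higgs1, (1.5) p.604] -/
theorem bondInner_zero_left {P : Params} {k : ℕ} (A : VecField P k) : bondInner (0 : VecField P k) A = 0 := by
  simp [bondInner]

/-- `⟨0, φ⟩ = 0` for the scalar product (1.5) on site functions. [cite: Balaban1982Higgs1, (1.5) p.604] -/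
theorem siteInner_zero_left {P : Params} {k N : ℕ} (φ : ScalarField P k N) :
    siteInner (0 : ScalarField P k N) φ = 0 := by
  simp [siteInner]

/-- KNITTING (kernel-checked): at zero sources the generating functional IS the renormalized partition function,
`Z^ε(0, 0) = Z^ε` ((1.15) with J = f = 0 is (1.10)). [cite: Balaban1982Higgs1, (1.10) p.605, (1.15) p.606] -/
theorem genFn_zero_zero (P : Params) : genFn D P 0 0 = D.zRen P := by
  simp only [genFn, bondInner_zero_left, siteInner_zero_left, add_zero, zRen_eq_partitionFn, partitionFn]

/-! ## 3. The concrete source family and (1.15) instantiated -/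

/-- The CONCRETE SOURCE FAMILY of the model: r01's cutoff family (`eps` ↤ ε, `vol` ↤ |T_ε|, `Z` ↤ Z^ε) extended by
the sources of (1.15) — at the admissible lattice `P`, `Src` ↤ all pairs `(J, f)` (vector field × scalar field on
`T_ε`), `nJ`, `nf` ↤ the sup norms `‖J‖_∞ = max_b |J_b|`, `‖f‖_∞ = max_x |f(x)|` (*"‖·‖ is some norm, e.g. we can
take the norm of L^∞"*), `ZS` ↤ `Z^ε(J, f)` (`genFn`).  The instance of r14's abstract `B1LowerBound.SourceFamily`
at which (1.15) is printed. [cite: Balaban1982Higgs1, (1.15) p.606] -/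
noncomputable def sourceFamily : B1LowerBound.SourceFamily {P : Params // D.Admissible P} where
  toCutoffFamily := D.cutoffFamily
  Src P := VecField P.1 0 × ScalarField P.1 0 D.N
  nJ _ s := ‖s.1‖
  nf _ s := ‖s.2‖
  ZS P s := genFn D P.1 s.1 s.2

/-- The source family extends r01's cutoff family (definitional). [cite: Balaban1982Higgs1, (1.14)–(1.15) p.606] -/
theorem sourceFamily_toCutoffFamily : (sourceFamily D).toCutoffFamily = D.cutoffFamily := rfl

/-- DICTIONARY (kernel-checked unfolding): (1.15) p. 606 at the concrete source family of the lattice model IS r14's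
statement of record `B1LowerBound.Ext115Printed (sourceFamily D)` (no new `Prop` is minted for it; the print gives
no proof — *"Using the same method of proof we can extend the Theorem in several ways"*), and it reads verbatim as —
continuous functions `E₋, E₊` of `(‖J‖, ‖f‖)` chosen before the lattice, and on every admissible lattice, for ALL
sources `J, f`, `exp(−E₋(‖J‖,‖f‖)|T_ε|) ≤ Z^ε(J,f) ≤ exp(E₊(‖J‖,‖f‖)|T_ε|)`. [cite: Balaban1982Higgs1, (1.15) p.606] -/
theorem ext115Printed_sourceFamily_iff :
    B1LowerBound.Ext115Printed (sourceFamily D) ↔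
      ∃ Em Ep : ℝ → ℝ → ℝ, Continuous (Function.uncurry Em) ∧ Continuous (Function.uncurry Ep) ∧
        ∀ P : Params, D.Admissible P → ∀ (J : VecField P 0) (f : ScalarField P 0 D.N),
          Real.exp (-(Em ‖J‖ ‖f‖ * volT P)) ≤ genFn D P J f ∧
            genFn D P J f ≤ Real.exp (Ep ‖J‖ ‖f‖ * volT P) := by
  constructor
  · rintro ⟨Em, Ep, hEm, hEp, h⟩
    exact ⟨Em, Ep, hEm, hEp, fun P hP J f => h ⟨P, hP⟩ (J, f)⟩
  · rintro ⟨Em, Ep, hEm, hEp, h⟩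
    exact ⟨Em, Ep, hEm, hEp, fun P s => h P.1 P.2 s.1 s.2⟩

/-- KNITTING (kernel-checked): (1.15) at the concrete source family implies the Theorem (1.14) at the concrete
cutoff family — take `J = f = 0` (`genFn_zero_zero`) and `E_∓ := E_∓(0, 0)`.
[cite: Balaban1982Higgs1, (1.14)–(1.15) p.606] -/
theorem thmPrinted_sourceFamily_of_ext115Printed (h : B1LowerBound.Ext115Printed (sourceFamily D)) :
    B1LowerBound.ThmPrinted D.cutoffFamily :=
  thmPrinted_of_ext115Printed (sourceFamily D) 0 0 (fun _ => ((0 : VecField _ 0), (0 : ScalarField _ 0 D.N)))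
    (fun _ => norm_zero) (fun _ => norm_zero) (fun P => genFn_zero_zero D P.1) h

/-- KNITTING (kernel-checked): (1.15) at the concrete source family implies r01's instantiated Theorem `Thm114`
(whose standing hypotheses are then not needed). [cite: Balaban1982Higgs1, (1.14)–(1.15) p.606] -/
theorem thm114_of_ext115Printed (h : B1LowerBound.Ext115Printed (sourceFamily D)) : Thm114 D :=
  fun _ _ _ _ _ => thmPrinted_sourceFamily_of_ext115Printed D h

/-- … and hence B1's lower-bound half `LowerBound114` (via r01's `lowerBound114_of_thm114`).
[cite: Balaban1982Higgs1, (1.14)–(1.15) p.606] -/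
theorem lowerBound114_of_ext115Printed (h : B1LowerBound.Ext115Printed (sourceFamily D)) : LowerBound114 D :=
  lowerBound114_of_thm114 D (thm114_of_ext115Printed D h)

end Model

/-! ## 4. v1.1 — the counterterm-GENERIC forms and the REPAIRED concrete instance

After the typer g24 semantic audit `B1Eq113OneSidedDerivatives` (p330976: under Lean's two-sided `iteratedDeriv` the
v1.0 `ModelData.e1` drops every `λ`-counterterm of (1.13)) and r01's repair `B1Sect1Statements` v1.1 (p331274:
`ModelData.zRenWith P E₁` / `cutoffFamilyWith E₁` / `Thm114With D E₁` for an ARBITRARY vacuum counterterm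
`E₁ : Params → ℝ`, and the repaired decls of record `e1R` (one-sided (1.13)), `zRenR`, `cutoffFamilyR`, `Thm114R`),
sections 2–3 are re-threaded ONCE over `E₁` and specialised: the v1.0 objects are the instances at `E₁ = e1`
(definitionally, `…_eq_…With`), the REPAIRED concrete instance of row B1.Eq1.15 is `sourceFamilyR = sourceFamilyWith D
D.e1R`, and the knitting (1.15) ⇒ (1.14) holds for every `E₁` (`thm114With_of_ext115Printed`), in particular for the
repaired reading (`thm114R_of_ext115Printed`).  Append-only: nothing of v1.0 is changed. -/

section Generic

variable (D : ModelData)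

/-- The couplings of `Z^ε` WITH AN ARBITRARY VACUUM COUNTERTERM `E₁` (r01's `ModelData.zRenWith`): charge `e`,
`m₀² = m² + δm²(ε, e, λ)`, `λ`, `μ₀²`, `E = E₀ + E₁`. [cite: Balaban1982Higgs1, (1.10)–(1.13) pp.605–606] -/
noncomputable def couplingsWith (P : Params) (E₁ : ℝ) : Couplings :=
  ⟨D.msq + D.δmsq P.ε D.C.e D.lam, D.lam, D.mu0sq, D.e0 P + E₁⟩

/-- dictionary (definitional): the v1.0 `couplings` are `couplingsWith` at `E₁ = e1 P`.
[cite: Balaban1982Higgs1, (1.10)–(1.13) pp.605–606] -/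
theorem couplings_eq_couplingsWith (P : Params) : couplings D P = couplingsWith D P (D.e1 P) := rfl

/-- DICTIONARY (definitional): r01's `zRenWith P E₁` is the partition function (1.10) of `HiggsLattice` at
`couplingsWith D P E₁`. [cite: Balaban1982Higgs1, (1.10)–(1.13) pp.605–606] -/
theorem zRenWith_eq_partitionFn (P : Params) (E₁ : ℝ) :
    D.zRenWith P E₁ = partitionFn P 0 D.N D.C (couplingsWith D P E₁) := rfl

/-- in particular the REPAIRED `Z^ε` (`zRenR`, `E₁ = e1R`) is (1.10) at `couplingsWith D P (D.e1R P)`.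
[cite: Balaban1982Higgs1, (1.10)–(1.13) pp.605–606] -/
theorem zRenR_eq_partitionFn (P : Params) : D.zRenR P = partitionFn P 0 D.N D.C (couplingsWith D P (D.e1R P)) := rfl

/-- **Z^ε(J, f) WITH AN ARBITRARY VACUUM COUNTERTERM `E₁`** — the middle member of (1.15),
`∫dA∫dφ exp(−S^ε(A,φ) + ⟨J,A⟩ + ⟨f,φ⟩)` with the action at `couplingsWith D P E₁`. [cite: Balaban1982Higgs1, (1.15) p.606] -/
noncomputable def genFnWith (P : Params) (E₁ : ℝ) (J : VecField P 0) (f : ScalarField P 0 D.N) : ℝ :=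
  ∫ Φ : VecField P 0 × ScalarField P 0 D.N,
    Real.exp (-action D.C (couplingsWith D P E₁) Φ.1 Φ.2 + bondInner J Φ.1 + siteInner f Φ.2)

/-- dictionary (definitional): the v1.0 `genFn` is `genFnWith` at `E₁ = e1 P`. [cite: Balaban1982Higgs1, (1.15) p.606] -/
theorem genFn_eq_genFnWith (P : Params) (J : VecField P 0) (f : ScalarField P 0 D.N) :
    genFn D P J f = genFnWith D P (D.e1 P) J f := rfl

/-- KNITTING: at zero sources `Z^ε(0, 0) = Z^ε`, for every vacuum counterterm. [cite: Balaban1982Higgs1, (1.10) p.605, (1.15) p.606] -/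
theorem genFnWith_zero_zero (P : Params) (E₁ : ℝ) : genFnWith D P E₁ 0 0 = D.zRenWith P E₁ := by
  simp only [genFnWith, bondInner_zero_left, siteInner_zero_left, add_zero, zRenWith_eq_partitionFn, partitionFn]

/-- The concrete source family WITH AN ARBITRARY VACUUM COUNTERTERM `E₁ : Params → ℝ`: r01's `cutoffFamilyWith E₁`
extended by the sources of (1.15) (all pairs `(J, f)`, sup norms, `ZS` ↤ `genFnWith … (E₁ P)`).
[cite: Balaban1982Higgs1, (1.15) p.606] -/
noncomputable def sourceFamilyWith (E₁ : Params → ℝ) : B1LowerBound.SourceFamily {P : Params // D.Admissible P} where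
  toCutoffFamily := D.cutoffFamilyWith E₁
  Src P := VecField P.1 0 × ScalarField P.1 0 D.N
  nJ _ s := ‖s.1‖
  nf _ s := ‖s.2‖
  ZS P s := genFnWith D P.1 (E₁ P.1) s.1 s.2

/-- dictionary (definitional): the v1.0 `sourceFamily` is `sourceFamilyWith` at `E₁ = e1`.
[cite: Balaban1982Higgs1, (1.15) p.606] -/
theorem sourceFamily_eq_sourceFamilyWith : sourceFamily D = sourceFamilyWith D D.e1 := rfl

/-- **The REPAIRED concrete source family of the model (v1.1 decl for the concrete instance of row B1.Eq1.15)**: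
`sourceFamilyWith` at the repaired one-sided counterterm `E₁ = e1R` (r01's `B1Sect1Statements` v1.1), i.e. r01's
`cutoffFamilyR` extended by the sources of (1.15). [cite: Balaban1982Higgs1, (1.15) p.606] -/
noncomputable def sourceFamilyR : B1LowerBound.SourceFamily {P : Params // D.Admissible P} :=
  sourceFamilyWith D D.e1R

/-- `sourceFamilyR` extends r01's repaired cutoff family `cutoffFamilyR` (definitional).
[cite: Balaban1982Higgs1, (1.14)–(1.15) p.606] -/
theorem sourceFamilyR_toCutoffFamily : (sourceFamilyR D).toCutoffFamily = D.cutoffFamilyR := rfl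

/-- DICTIONARY (kernel-checked unfolding): (1.15) at `sourceFamilyWith D E₁` reads verbatim — continuous
`E₋, E₊` of `(‖J‖, ‖f‖)` chosen before the lattice; on every admissible lattice, for all sources,
`exp(−E₋(‖J‖,‖f‖)|T_ε|) ≤ Z^ε(J,f) ≤ exp(E₊(‖J‖,‖f‖)|T_ε|)` with `Z^ε(J,f) = genFnWith D P (E₁ P) J f`.
[cite: Balaban1982Higgs1, (1.15) p.606] -/
theorem ext115Printed_sourceFamilyWith_iff (E₁ : Params → ℝ) :
    B1LowerBound.Ext115Printed (sourceFamilyWith D E₁) ↔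
      ∃ Em Ep : ℝ → ℝ → ℝ, Continuous (Function.uncurry Em) ∧ Continuous (Function.uncurry Ep) ∧
        ∀ P : Params, D.Admissible P → ∀ (J : VecField P 0) (f : ScalarField P 0 D.N),
          Real.exp (-(Em ‖J‖ ‖f‖ * volT P)) ≤ genFnWith D P (E₁ P) J f ∧
            genFnWith D P (E₁ P) J f ≤ Real.exp (Ep ‖J‖ ‖f‖ * volT P) := by
  constructor
  · rintro ⟨Em, Ep, hEm, hEp, h⟩
    exact ⟨Em, Ep, hEm, hEp, fun P hP J f => h ⟨P, hP⟩ (J, f)⟩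
  · rintro ⟨Em, Ep, hEm, hEp, h⟩
    exact ⟨Em, Ep, hEm, hEp, fun P s => h P.1 P.2 s.1 s.2⟩

/-- KNITTING (kernel-checked): (1.15) at `sourceFamilyWith D E₁` implies the Theorem (1.14) at `cutoffFamilyWith E₁`
(`J = f = 0`, `E_∓ := E_∓(0,0)`) — for EVERY vacuum counterterm `E₁`. [cite: Balaban1982Higgs1, (1.14)–(1.15) p.606] -/
theorem thmPrinted_sourceFamilyWith_of_ext115Printed (E₁ : Params → ℝ)
    (h : B1LowerBound.Ext115Printed (sourceFamilyWith D E₁)) :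
    B1LowerBound.ThmPrinted (D.cutoffFamilyWith E₁) :=
  thmPrinted_of_ext115Printed (sourceFamilyWith D E₁) 0 0 (fun _ => ((0 : VecField _ 0), (0 : ScalarField _ 0 D.N)))
    (fun _ => norm_zero) (fun _ => norm_zero) (fun P => genFnWith_zero_zero D P.1 (E₁ P.1)) h

/-- KNITTING: (1.15) at `sourceFamilyWith D E₁` implies r01's `Thm114With D E₁`. [cite: Balaban1982Higgs1, (1.14)–(1.15) p.606] -/
theorem thm114With_of_ext115Printed (E₁ : Params → ℝ) (h : B1LowerBound.Ext115Printed (sourceFamilyWith D E₁)) :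
    Thm114With D E₁ :=
  fun _ _ _ _ _ => thmPrinted_sourceFamilyWith_of_ext115Printed D E₁ h

/-- KNITTING, REPAIRED READING: (1.15) at the repaired concrete source family implies r01's repaired instantiated
Theorem `Thm114R` (decl of record of the concrete instance of row B1.Thm@606 since `B1Sect1Statements` v1.1).
[cite: Balaban1982Higgs1, (1.14)–(1.15) p.606] -/
theorem thm114R_of_ext115Printed (h : B1LowerBound.Ext115Printed (sourceFamilyR D)) : Thm114R D :=
  thm114With_of_ext115Printed D D.e1R h

/-- … and hence B1's lower-bound half in the repaired reading, `LowerBound114R`.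
[cite: Balaban1982Higgs1, (1.14)–(1.15) p.606] -/
theorem lowerBound114R_of_ext115Printed (h : B1LowerBound.Ext115Printed (sourceFamilyR D)) : LowerBound114R D :=
  lowerBound114R_of_thm114R D (thm114R_of_ext115Printed D h)

end Generic

end Literature.MathematicalPhysics.QuantumFieldTheory.Balaban1983to89.B1Eq115GeneratingFunctional
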